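import Literature.MathematicalPhysics.QuantumFieldTheory.Balaban1983to89.Node00.Record13SepLiveSelector
import Literature.MathematicalPhysics.QuantumFieldTheory.Balaban1983to89.Node00.Record13SepCo

/-!
# NODE 00 (YM-PLAN Track A) — STAGE 13, REV 20 ∕ CLASS EDITION (director-ym LINE №149 (3), №150): THE K0a FACES AND THE ⁵ SOCKET FOR node00-def-T's PROVISOS
# `Stage13Params.Provisos₁₃SepCo` (`Record13SepCo` v1.4: row P11 `bg` = def-R's `BgProvisoΛ` over the support `suppOfRecord₁₃SepCo` — regular retained data AT SEPARATED sequences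
# SATISFYING PRINT'S (7) `Sect2.DataSmall7P` (membership ⟨hWreg, hsep, h7⟩, NO (1.9) guard) — READ AT THE TWO-CASE CARRIER `UbgOfRecord₁₃Co` (level `n+1` = def-R's minimiser
# `UbgMSCoOfRecord` over print's FULL class (6) = [6] (1.7) ∧ (1.9), node00-def-R FILE 22 `LargeFieldBackgroundCoOfRecord`), along PARTITION-COMPATIBLE runs; fields
# `hM : ∃ a, θ.τ9.M = F.L ^ a`, `hM₁ : θ.ν.M₁ ∣ θ.τ9.M`); the bg-free CORE `Provisos₁₃Core` is v1.2's, untouched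

Cell `pub-ymgap`, seat `pub-ymgap-node00-def-K0a` (g7), FILE 15a = FILE 12a (`Record13SepLiveSelector`) TOKEN-SWAPPED `…₁₃Sep ↦ …₁₃SepCo`, `UbgOfRecord₁₃ ↦ UbgOfRecord₁₃Co`, with the
third membership conjunct (print's (7) on the datum) threaded through the unfolding `iff` and the adapters, and the fields `hM`∕`hM₁` carried as displayed hypotheses of the constructors
(discharged by `⟨0, rfl⟩`∕`dvd_refl _` at every K0a witness, M = M₁ = 1); companion FILE 15b `Node00/Record13SepCoInhabitedOfClassC1` composes the socket with FILE 14c's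
background-generic per-datum supplier at `θ₁₅ᶜᶜ¹`.  [III] = [Balaban1988Convergent], [IV] = [Balaban1989LargeFieldI], [6] = [Balaban1985RegularSpaces], [15] = [Balaban1985Variational].

WHAT THIS FILE PROVES (theorems only).
* §1 at a generic `θ`: `Stage13Params.bgProvisoΛ_suppSepCo_iff` (token over `suppOfRecord₁₃SepCo` at `UbgOfRecord₁₃Co` ⟺ the GUARDED SEPARATED BODY `∀ s, SeqSeparated θ.ν.M₁ s →
  ∀ 𝐖 ∈ suppOfRecord₁₃ θ p n s, Sect2.DataSmall7P … 𝐖 → ∀ j X, (I) ∧ (MS)` at `UbgOfRecord₁₃Co θ p n s 𝐖`), `suppOfRecord₁₃SepCo_liveRepin₁₃` and `UbgOfRecord₁₃Co_liveRepin₁₃` (`rfl`),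
  `Stage13Params.provisos₁₃SepCo_of_core (hc) (hM) (hM₁) (hbg)`, `Stage13Params.provisos₁₃SepCo_liveRepin₁₃_of_bgSepCo (hres) (hM) (hM₁) (hbgSepCo)` (the v1.4 provisos at
  the ₁₃ live re-pin of every parameter carrying K0b's residuals ⟸ THE GUARDED ROW ALONE; core by FILE 12a's `provisos₁₃Core_liveRepin₁₃_of_hasResiduals`; adapter
  `fun p n hn hw hpc s W hW => hbgSepCo p n hn hw hpc s hW.2.1 W hW.1 hW.2.2`).
* §2 at the all-numerics family: `provisos₁₃SepCo_theta13LiveOfNumerics_of_bgSepCo`, ★★★ THE ⁵ SOCKET `exists_k0SepCo_of_bgSepCo_theta13LiveOfNumerics (F) (hn) (hε')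
  (hM : ∃ a, n.τ9.M = F.L ^ a) (hM₁ : n.ν.M₁ ∣ n.τ9.M) (hbgSepCo) : ∃ θ : Stage13Params F 2, θ.Provisos₁₃SepCo F 2 ∧ (θ.ZtUnity F 2 ∧ θ.SlotsNondegenerate₁₃ F 2) ∧ θ.Admissible F 2`.

HONEST FRAMING.  Bookkeeping (structure constructors, an unfolding `iff`, instantiation by name); the guarded row is a DISPLAYED HYPOTHESIS; nothing of Bałaban asserted; NOT a
discharge; counts unmoved (typed 28∕28 · discharged 5∕28); one finite 𝕋⁴ programme at fixed ε — NOT continuum ∕ OS ∕ mass gap ∕ Clay.  No `sorry`, `axiom`, `def`, `instance`, `notation`.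
-/

noncomputable section

open MeasureTheory
open scoped Matrix.Norms.L2Operator

namespace Literature.MathematicalPhysics.QuantumFieldTheory.Balaban1983to89.Node00

open T4Continuum B14.Eq218Concrete B15DeterminingSets B15RopTotal FlowStep FlowStepRuns

/-! ## §1. At a generic Stage-13 parameter: token ⟺ (7)-guarded separated body at the Co carrier; `Provisos₁₃SepCo` at the ₁₃ live re-pin from the core and the guarded row -/

section Repin13SepCo

variable (F : T4Family) (N : ℕ) [NeZero N] (θ : Stage13Params F N)

/-- **THE TOKEN OVER THE (7)-GUARDED SEPARATED SUPPORT AT THE Co CARRIER UNFOLDS TO THE GUARDED BODY, level by level**: def-R's `BgProvisoΛ` over def-T's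
`suppOfRecord₁₃SepCo θ p n s = {𝐖 ∈ suppOfRecord₁₃ θ p n s | Sect2.SeqSeparated θ.ν.M₁ s ∧ Sect2.DataSmall7P … 𝐖}` at `UbgOfRecord₁₃Co θ p n` ⟺ the two memberships demanded for PRINT'S sequences
([6] (1.3)–(1.6)) and PRINT'S data ([15] (7)) only, for def-R's class-(6) background. [cite: Balaban1985RegularSpaces, (1.3)–(1.9) p.77; Balaban1985Variational, (6)–(7) p.278; Balaban1988Convergent, (2.12) p.256, (2.27)–(2.28) p.259, (2.34)–(2.41) p.261 (bookkeeping)] -/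
theorem Stage13Params.bgProvisoΛ_suppSepCo_iff (p : B12.RunParams) (n : ℕ) :
    BgProvisoΛ F N p.K (settingOfRecord₁₃ F N θ p) (θ.Rz p.K) θ.τ9.M n (suppOfRecord₁₃SepCo F N θ p n) (UbgOfRecord₁₃Co F N θ p n) ↔
      ∀ s : SeqOfRecord F θ.ν θ.τ9.M (gOfRecord₁₃ F N θ p) p.K n, Sect2.SeqSeparated θ.ν.M₁ s →
      ∀ W : MSField (F.P p.K) (SU N), W ∈ suppOfRecord₁₃ F N θ p n s →
      Sect2.DataSmall7P (avOfRecord F N p.K) s.Ω n (fun j => θ.s2.cR * epsOfRecord θ.ν (gOfRecord₁₃ F N θ p) j) W →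
      ∀ j, 1 ≤ j → j ≤ n → ∀ X : (Sect2.domSys (F.P p.K) θ.τ9.M j).Dom,
      (Sect2.domSites (F.P p.K) θ.τ9.M j X ⊆ s.Λ j →
        Sect2.ofBackgroundC (settingOfRecord₁₃ F N θ p).ι (UbgOfRecord₁₃Co F N θ p n s W) ∈
          Sect2.spaceI (settingOfRecord₁₃ F N θ p) (θ.Rz p.K) θ.τ9.M j (Sect2.domSites (F.P p.K) θ.τ9.M j X)
            ((settingOfRecord₁₃ F N θ p).lf.alpha0 ((settingOfRecord₁₃ F N θ p).flow.g j)) ((settingOfRecord₁₃ F N θ p).lf.alpha1 ((settingOfRecord₁₃ F N θ p).flow.g j))) ∧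
      (Sect2.admB (F.P p.K) θ.ν θ.τ9.M (gOfRecord₁₃ F N θ p) s.Ω s.Λ j (Sect2.domSites (F.P p.K) θ.τ9.M j X) = true →
        Sect2.ofBackgroundC (settingOfRecord₁₃ F N θ p).ι (UbgOfRecord₁₃Co F N θ p n s W) ∈
          Sect2.spaceMS (settingOfRecord₁₃ F N θ p) (θ.Rz p.K) θ.τ9.M j (Sect2.domSites (F.P p.K) θ.τ9.M j X) s.Ω) :=
  ⟨fun h s hs W hW h7 => h s W ⟨hW, hs, h7⟩, fun h s W hW => h s hW.2.1 W hW.1 hW.2.2⟩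

/-- The (7)-guarded separated support is selector-blind: at the ₁₃ re-pin it IS `θ`'s (`rfl`). [cite: Balaban1988Convergent, (2.10) p.256 (bookkeeping)] -/
theorem Stage13Params.suppOfRecord₁₃SepCo_liveRepin₁₃ (p : B12.RunParams) (n : ℕ) :
    suppOfRecord₁₃SepCo F N (θ.liveRepin₁₃ F N) p n = suppOfRecord₁₃SepCo F N θ p n := rfl

/-- The Co carrier is selector-blind: at the ₁₃ re-pin it IS `θ`'s (`rfl`). [cite: Balaban1988Convergent, (2.12) p.256 (bookkeeping)] -/
theorem Stage13Params.UbgOfRecord₁₃Co_liveRepin₁₃ (p : B12.RunParams) (n : ℕ) :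
    UbgOfRecord₁₃Co F N (θ.liveRepin₁₃ F N) p n = UbgOfRecord₁₃Co F N θ p n := rfl

variable {F N θ}

/-- **`Provisos₁₃SepCo` = THE bg-FREE CORE + THE PINS `hM`∕`hM₁` + THE (7)-GUARDED ROW AT THE Co CARRIER** (named-field constructor; the token is the field's type verbatim). [cite: Balaban1988Convergent, (2.18) p.257, (2.28) p.259, p.245 (bookkeeping)] -/
theorem Stage13Params.provisos₁₃SepCo_of_core (hc : θ.Provisos₁₃Core F N) (hM : ∃ a : ℕ, θ.τ9.M = F.L ^ a) (hM₁ : θ.ν.M₁ ∣ θ.τ9.M)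
    (hbg : ∀ (p : B12.RunParams) (n : ℕ), n ≤ p.K → Step.InInterval θ.γ n (gOfRecord₁₃ F N θ p) → PartCompat₁₃ F N θ p n →
      BgProvisoΛ F N p.K (settingOfRecord₁₃ F N θ p) (θ.Rz p.K) θ.τ9.M n (suppOfRecord₁₃SepCo F N θ p n) (UbgOfRecord₁₃Co F N θ p n)) :
    θ.Provisos₁₃SepCo F N where
  intPiece := hc.intPiece
  measω := hc.measω
  measChi := hc.measChi
  zetaUnity := hc.zetaUnity
  zetaAbs := hc.zetaAbs
  rstep := hc.rstep
  rzLaws := hc.rzLaws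
  ztLaws := hc.ztLaws
  ztLocal := hc.ztLocal
  hM := hM
  hM₁ := hM₁
  bg := hbg

/-- **★ `Provisos₁₃SepCo` AT THE ₁₃ LIVE RE-PIN OF A PARAMETER CARRYING K0b's RESIDUALS FROM THE (7)-GUARDED SEPARATED ROW AT THE Co CARRIER ALONE** (body form; core OUTRIGHT by
FILE 12a's `provisos₁₃Core_liveRepin₁₃_of_hasResiduals`; adapter `fun p n hn hw hpc s W hW => hbgSepCo p n hn hw hpc s hW.2.1 W hW.1 hW.2.2`). [cite: Balaban1988Convergent, (2.12) p.256, (2.28) p.259, (3.16) p.268, (3.22) p.269; Balaban1985RegularSpaces, (1.3)–(1.9) p.77; Balaban1985Variational, (6)–(7) p.278; Balaban1989LargeFieldI, (0.3)–(0.4) p.176 (bookkeeping)] -/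
theorem Stage13Params.provisos₁₃SepCo_liveRepin₁₃_of_bgSepCo (hres : θ.HasResidualsOfRecord F N) (hM : ∃ a : ℕ, θ.τ9.M = F.L ^ a) (hM₁ : θ.ν.M₁ ∣ θ.τ9.M)
    (hbgSepCo : ∀ (p : B12.RunParams) (n : ℕ), n ≤ p.K → Step.InInterval (θ.liveRepin₁₃ F N).γ n (gOfRecord₁₃ F N (θ.liveRepin₁₃ F N) p) → PartCompat₁₃ F N (θ.liveRepin₁₃ F N) p n →
      ∀ s : SeqOfRecord F (θ.liveRepin₁₃ F N).ν (θ.liveRepin₁₃ F N).τ9.M (gOfRecord₁₃ F N (θ.liveRepin₁₃ F N) p) p.K n, Sect2.SeqSeparated (θ.liveRepin₁₃ F N).ν.M₁ s →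
      ∀ W : MSField (F.P p.K) (SU N), W ∈ suppOfRecord₁₃ F N (θ.liveRepin₁₃ F N) p n s →
      Sect2.DataSmall7P (avOfRecord F N p.K) s.Ω n (fun j => (θ.liveRepin₁₃ F N).s2.cR * epsOfRecord (θ.liveRepin₁₃ F N).ν (gOfRecord₁₃ F N (θ.liveRepin₁₃ F N) p) j) W →
      ∀ j, 1 ≤ j → j ≤ n → ∀ X : (Sect2.domSys (F.P p.K) (θ.liveRepin₁₃ F N).τ9.M j).Dom,
      (Sect2.domSites (F.P p.K) (θ.liveRepin₁₃ F N).τ9.M j X ⊆ s.Λ j →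
        Sect2.ofBackgroundC (settingOfRecord₁₃ F N (θ.liveRepin₁₃ F N) p).ι (UbgOfRecord₁₃Co F N (θ.liveRepin₁₃ F N) p n s W) ∈
          Sect2.spaceI (settingOfRecord₁₃ F N (θ.liveRepin₁₃ F N) p) ((θ.liveRepin₁₃ F N).Rz p.K) (θ.liveRepin₁₃ F N).τ9.M j (Sect2.domSites (F.P p.K) (θ.liveRepin₁₃ F N).τ9.M j X)
            ((settingOfRecord₁₃ F N (θ.liveRepin₁₃ F N) p).lf.alpha0 ((settingOfRecord₁₃ F N (θ.liveRepin₁₃ F N) p).flow.g j)) ((settingOfRecord₁₃ F N (θ.liveRepin₁₃ F N) p).lf.alpha1 ((settingOfRecord₁₃ F N (θ.liveRepin₁₃ F N) p).flow.g j))) ∧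
      (Sect2.admB (F.P p.K) (θ.liveRepin₁₃ F N).ν (θ.liveRepin₁₃ F N).τ9.M (gOfRecord₁₃ F N (θ.liveRepin₁₃ F N) p) s.Ω s.Λ j (Sect2.domSites (F.P p.K) (θ.liveRepin₁₃ F N).τ9.M j X) = true →
        Sect2.ofBackgroundC (settingOfRecord₁₃ F N (θ.liveRepin₁₃ F N) p).ι (UbgOfRecord₁₃Co F N (θ.liveRepin₁₃ F N) p n s W) ∈
          Sect2.spaceMS (settingOfRecord₁₃ F N (θ.liveRepin₁₃ F N) p) ((θ.liveRepin₁₃ F N).Rz p.K) (θ.liveRepin₁₃ F N).τ9.M j (Sect2.domSites (F.P p.K) (θ.liveRepin₁₃ F N).τ9.M j X) s.Ω)) :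
    (θ.liveRepin₁₃ F N).Provisos₁₃SepCo F N :=
  (θ.liveRepin₁₃ F N).provisos₁₃SepCo_of_core (θ.provisos₁₃Core_liveRepin₁₃_of_hasResiduals hres) hM hM₁
    fun p n hn hw hpc s W hW => hbgSepCo p n hn hw hpc s hW.2.1 W hW.1 hW.2.2

end Repin13SepCo

/-! ## §2. At the all-numerics family `θ₁₃(n, ε₂₉)`: `Provisos₁₃SepCo` from the guarded row alone, and ★★★ THE ⁵ SOCKET -/

section AllNumericsSepCo

variable (F : T4Family) (N : ℕ) [NeZero N] (n : Stage12Numerics) (ε₂₉ : ℝ)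

/-- **★ `Provisos₁₃SepCo` AT EVERY MEMBER OF THE ALL-NUMERICS FAMILY CARRYING K0b's RESIDUALS, FROM THE (7)-GUARDED SEPARATED ROW AT THE Co CARRIER THERE ALONE** (plus the two pins).
[cite: Balaban1988Convergent, (2.18) p.257, (2.28) p.259, (3.16) p.268, (3.22) p.269; Balaban1985RegularSpaces, (1.3)–(1.9) p.77; Balaban1985Variational, (6)–(7) p.278; Balaban1989LargeFieldI, (0.3)–(0.4) p.176 (bookkeeping)] -/
theorem provisos₁₃SepCo_theta13LiveOfNumerics_of_bgSepCo (hM : ∃ a : ℕ, n.τ9.M = F.L ^ a) (hM₁ : n.ν.M₁ ∣ n.τ9.M)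
    (hbgSepCo : ∀ (p : B12.RunParams) (m : ℕ), m ≤ p.K → Step.InInterval (theta13LiveOfNumerics F N n ε₂₉ (zeta316OfRecord F N n.ν n.τ9.M n.A₁) (RzOfRecord F N) (ZtOfRecord F N)).γ m (gOfRecord₁₃ F N (theta13LiveOfNumerics F N n ε₂₉ (zeta316OfRecord F N n.ν n.τ9.M n.A₁) (RzOfRecord F N) (ZtOfRecord F N)) p) → PartCompat₁₃ F N (theta13LiveOfNumerics F N n ε₂₉ (zeta316OfRecord F N n.ν n.τ9.M n.A₁) (RzOfRecord F N) (ZtOfRecord F N)) p m →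
      ∀ s : SeqOfRecord F (theta13LiveOfNumerics F N n ε₂₉ (zeta316OfRecord F N n.ν n.τ9.M n.A₁) (RzOfRecord F N) (ZtOfRecord F N)).ν (theta13LiveOfNumerics F N n ε₂₉ (zeta316OfRecord F N n.ν n.τ9.M n.A₁) (RzOfRecord F N) (ZtOfRecord F N)).τ9.M (gOfRecord₁₃ F N (theta13LiveOfNumerics F N n ε₂₉ (zeta316OfRecord F N n.ν n.τ9.M n.A₁) (RzOfRecord F N) (ZtOfRecord F N)) p) p.K m, Sect2.SeqSeparated (theta13LiveOfNumerics F N n ε₂₉ (zeta316OfRecord F N n.ν n.τ9.M n.A₁) (RzOfRecord F N) (ZtOfRecord F N)).ν.M₁ s →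
      ∀ W : MSField (F.P p.K) (SU N), W ∈ suppOfRecord₁₃ F N (theta13LiveOfNumerics F N n ε₂₉ (zeta316OfRecord F N n.ν n.τ9.M n.A₁) (RzOfRecord F N) (ZtOfRecord F N)) p m s →
      Sect2.DataSmall7P (avOfRecord F N p.K) s.Ω m (fun j => (theta13LiveOfNumerics F N n ε₂₉ (zeta316OfRecord F N n.ν n.τ9.M n.A₁) (RzOfRecord F N) (ZtOfRecord F N)).s2.cR * epsOfRecord (theta13LiveOfNumerics F N n ε₂₉ (zeta316OfRecord F N n.ν n.τ9.M n.A₁) (RzOfRecord F N) (ZtOfRecord F N)).ν (gOfRecord₁₃ F N (theta13LiveOfNumerics F N n ε₂₉ (zeta316OfRecord F N n.ν n.τ9.M n.A₁) (RzOfRecord F N) (ZtOfRecord F N)) p) j) W →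
      ∀ j, 1 ≤ j → j ≤ m → ∀ X : (Sect2.domSys (F.P p.K) (theta13LiveOfNumerics F N n ε₂₉ (zeta316OfRecord F N n.ν n.τ9.M n.A₁) (RzOfRecord F N) (ZtOfRecord F N)).τ9.M j).Dom,
      (Sect2.domSites (F.P p.K) (theta13LiveOfNumerics F N n ε₂₉ (zeta316OfRecord F N n.ν n.τ9.M n.A₁) (RzOfRecord F N) (ZtOfRecord F N)).τ9.M j X ⊆ s.Λ j →
        Sect2.ofBackgroundC (settingOfRecord₁₃ F N (theta13LiveOfNumerics F N n ε₂₉ (zeta316OfRecord F N n.ν n.τ9.M n.A₁) (RzOfRecord F N) (ZtOfRecord F N)) p).ι (UbgOfRecord₁₃Co F N (theta13LiveOfNumerics F N n ε₂₉ (zeta316OfRecord F N n.ν n.τ9.M n.A₁) (RzOfRecord F N) (ZtOfRecord F N)) p m s W) ∈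
          Sect2.spaceI (settingOfRecord₁₃ F N (theta13LiveOfNumerics F N n ε₂₉ (zeta316OfRecord F N n.ν n.τ9.M n.A₁) (RzOfRecord F N) (ZtOfRecord F N)) p) ((theta13LiveOfNumerics F N n ε₂₉ (zeta316OfRecord F N n.ν n.τ9.M n.A₁) (RzOfRecord F N) (ZtOfRecord F N)).Rz p.K) (theta13LiveOfNumerics F N n ε₂₉ (zeta316OfRecord F N n.ν n.τ9.M n.A₁) (RzOfRecord F N) (ZtOfRecord F N)).τ9.M j (Sect2.domSites (F.P p.K) (theta13LiveOfNumerics F N n ε₂₉ (zeta316OfRecord F N n.ν n.τ9.M n.A₁) (RzOfRecord F N) (ZtOfRecord F N)).τ9.M j X)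
            ((settingOfRecord₁₃ F N (theta13LiveOfNumerics F N n ε₂₉ (zeta316OfRecord F N n.ν n.τ9.M n.A₁) (RzOfRecord F N) (ZtOfRecord F N)) p).lf.alpha0 ((settingOfRecord₁₃ F N (theta13LiveOfNumerics F N n ε₂₉ (zeta316OfRecord F N n.ν n.τ9.M n.A₁) (RzOfRecord F N) (ZtOfRecord F N)) p).flow.g j)) ((settingOfRecord₁₃ F N (theta13LiveOfNumerics F N n ε₂₉ (zeta316OfRecord F N n.ν n.τ9.M n.A₁) (RzOfRecord F N) (ZtOfRecord F N)) p).lf.alpha1 ((settingOfRecord₁₃ F N (theta13LiveOfNumerics F N n ε₂₉ (zeta316OfRecord F N n.ν n.τ9.M n.A₁) (RzOfRecord F N) (ZtOfRecord F N)) p).flow.g j))) ∧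
      (Sect2.admB (F.P p.K) (theta13LiveOfNumerics F N n ε₂₉ (zeta316OfRecord F N n.ν n.τ9.M n.A₁) (RzOfRecord F N) (ZtOfRecord F N)).ν (theta13LiveOfNumerics F N n ε₂₉ (zeta316OfRecord F N n.ν n.τ9.M n.A₁) (RzOfRecord F N) (ZtOfRecord F N)).τ9.M (gOfRecord₁₃ F N (theta13LiveOfNumerics F N n ε₂₉ (zeta316OfRecord F N n.ν n.τ9.M n.A₁) (RzOfRecord F N) (ZtOfRecord F N)) p) s.Ω s.Λ j (Sect2.domSites (F.P p.K) (theta13LiveOfNumerics F N n ε₂₉ (zeta316OfRecord F N n.ν n.τ9.M n.A₁) (RzOfRecord F N) (ZtOfRecord F N)).τ9.M j X) = true →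
        Sect2.ofBackgroundC (settingOfRecord₁₃ F N (theta13LiveOfNumerics F N n ε₂₉ (zeta316OfRecord F N n.ν n.τ9.M n.A₁) (RzOfRecord F N) (ZtOfRecord F N)) p).ι (UbgOfRecord₁₃Co F N (theta13LiveOfNumerics F N n ε₂₉ (zeta316OfRecord F N n.ν n.τ9.M n.A₁) (RzOfRecord F N) (ZtOfRecord F N)) p m s W) ∈
          Sect2.spaceMS (settingOfRecord₁₃ F N (theta13LiveOfNumerics F N n ε₂₉ (zeta316OfRecord F N n.ν n.τ9.M n.A₁) (RzOfRecord F N) (ZtOfRecord F N)) p) ((theta13LiveOfNumerics F N n ε₂₉ (zeta316OfRecord F N n.ν n.τ9.M n.A₁) (RzOfRecord F N) (ZtOfRecord F N)).Rz p.K) (theta13LiveOfNumerics F N n ε₂₉ (zeta316OfRecord F N n.ν n.τ9.M n.A₁) (RzOfRecord F N) (ZtOfRecord F N)).τ9.M j (Sect2.domSites (F.P p.K) (theta13LiveOfNumerics F N n ε₂₉ (zeta316OfRecord F N n.ν n.τ9.M n.A₁) (RzOfRecord F N) (ZtOfRecord F N)).τ9.M j X) s.Ω)) :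
    (theta13LiveOfNumerics F N n ε₂₉ (zeta316OfRecord F N n.ν n.τ9.M n.A₁) (RzOfRecord F N) (ZtOfRecord F N)).Provisos₁₃SepCo F N :=
  (theta13OfNumerics F N n ε₂₉ _ _ _).provisos₁₃SepCo_liveRepin₁₃_of_bgSepCo (hasResidualsOfRecord_theta13OfNumerics F N n ε₂₉) hM hM₁ hbgSepCo

/-- **★★★ THE ⁵ SOCKET — THE REV-20 K0 BODY FOR `F` AT `N = 2` AT ANY NUMERICS from `n.Pos`, `0 < ε₂₉`, the two pins and THE (7)-GUARDED SEPARATED ROW P11 AT THE Co CARRIER there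
ALONE** (row Z by K0b's residual laws, row P12 hypothesis-free, row G by `admissible_theta13LiveOfNumerics`).  A REDUCTION — NOT a discharge. [cite: Balaban1988Convergent, Thm 1 p.262, (2.7) p.255, (2.12) p.256, (2.28) p.259, (3.16)–(3.22) pp.268–269; Balaban1985RegularSpaces, (1.3)–(1.9) p.77; Balaban1985Variational, (6)–(7) p.278; Balaban1989LargeFieldI, (0.3)–(0.4) p.176 (bookkeeping)] -/
theorem exists_k0SepCo_of_bgSepCo_theta13LiveOfNumerics (F : T4Family) {n : Stage12Numerics} {ε₂₉ : ℝ} (hn : n.Pos) (hε' : 0 < ε₂₉) (hM : ∃ a : ℕ, n.τ9.M = F.L ^ a) (hM₁ : n.ν.M₁ ∣ n.τ9.M)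
    (hbgSepCo : ∀ (p : B12.RunParams) (m : ℕ), m ≤ p.K → Step.InInterval (theta13LiveOfNumerics F 2 n ε₂₉ (zeta316OfRecord F 2 n.ν n.τ9.M n.A₁) (RzOfRecord F 2) (ZtOfRecord F 2)).γ m (gOfRecord₁₃ F 2 (theta13LiveOfNumerics F 2 n ε₂₉ (zeta316OfRecord F 2 n.ν n.τ9.M n.A₁) (RzOfRecord F 2) (ZtOfRecord F 2)) p) → PartCompat₁₃ F 2 (theta13LiveOfNumerics F 2 n ε₂₉ (zeta316OfRecord F 2 n.ν n.τ9.M n.A₁) (RzOfRecord F 2) (ZtOfRecord F 2)) p m →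
      ∀ s : SeqOfRecord F (theta13LiveOfNumerics F 2 n ε₂₉ (zeta316OfRecord F 2 n.ν n.τ9.M n.A₁) (RzOfRecord F 2) (ZtOfRecord F 2)).ν (theta13LiveOfNumerics F 2 n ε₂₉ (zeta316OfRecord F 2 n.ν n.τ9.M n.A₁) (RzOfRecord F 2) (ZtOfRecord F 2)).τ9.M (gOfRecord₁₃ F 2 (theta13LiveOfNumerics F 2 n ε₂₉ (zeta316OfRecord F 2 n.ν n.τ9.M n.A₁) (RzOfRecord F 2) (ZtOfRecord F 2)) p) p.K m, Sect2.SeqSeparated (theta13LiveOfNumerics F 2 n ε₂₉ (zeta316OfRecord F 2 n.ν n.τ9.M n.A₁) (RzOfRecord F 2) (ZtOfRecord F 2)).ν.M₁ s →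
      ∀ W : MSField (F.P p.K) (SU 2), W ∈ suppOfRecord₁₃ F 2 (theta13LiveOfNumerics F 2 n ε₂₉ (zeta316OfRecord F 2 n.ν n.τ9.M n.A₁) (RzOfRecord F 2) (ZtOfRecord F 2)) p m s →
      Sect2.DataSmall7P (avOfRecord F 2 p.K) s.Ω m (fun j => (theta13LiveOfNumerics F 2 n ε₂₉ (zeta316OfRecord F 2 n.ν n.τ9.M n.A₁) (RzOfRecord F 2) (ZtOfRecord F 2)).s2.cR * epsOfRecord (theta13LiveOfNumerics F 2 n ε₂₉ (zeta316OfRecord F 2 n.ν n.τ9.M n.A₁) (RzOfRecord F 2) (ZtOfRecord F 2)).ν (gOfRecord₁₃ F 2 (theta13LiveOfNumerics F 2 n ε₂₉ (zeta316OfRecord F 2 n.ν n.τ9.M n.A₁) (RzOfRecord F 2) (ZtOfRecord F 2)) p) j) W →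
      ∀ j, 1 ≤ j → j ≤ m → ∀ X : (Sect2.domSys (F.P p.K) (theta13LiveOfNumerics F 2 n ε₂₉ (zeta316OfRecord F 2 n.ν n.τ9.M n.A₁) (RzOfRecord F 2) (ZtOfRecord F 2)).τ9.M j).Dom,
      (Sect2.domSites (F.P p.K) (theta13LiveOfNumerics F 2 n ε₂₉ (zeta316OfRecord F 2 n.ν n.τ9.M n.A₁) (RzOfRecord F 2) (ZtOfRecord F 2)).τ9.M j X ⊆ s.Λ j →
        Sect2.ofBackgroundC (settingOfRecord₁₃ F 2 (theta13LiveOfNumerics F 2 n ε₂₉ (zeta316OfRecord F 2 n.ν n.τ9.M n.A₁) (RzOfRecord F 2) (ZtOfRecord F 2)) p).ι (UbgOfRecord₁₃Co F 2 (theta13LiveOfNumerics F 2 n ε₂₉ (zeta316OfRecord F 2 n.ν n.τ9.M n.A₁) (RzOfRecord F 2) (ZtOfRecord F 2)) p m s W) ∈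
          Sect2.spaceI (settingOfRecord₁₃ F 2 (theta13LiveOfNumerics F 2 n ε₂₉ (zeta316OfRecord F 2 n.ν n.τ9.M n.A₁) (RzOfRecord F 2) (ZtOfRecord F 2)) p) ((theta13LiveOfNumerics F 2 n ε₂₉ (zeta316OfRecord F 2 n.ν n.τ9.M n.A₁) (RzOfRecord F 2) (ZtOfRecord F 2)).Rz p.K) (theta13LiveOfNumerics F 2 n ε₂₉ (zeta316OfRecord F 2 n.ν n.τ9.M n.A₁) (RzOfRecord F 2) (ZtOfRecord F 2)).τ9.M j (Sect2.domSites (F.P p.K) (theta13LiveOfNumerics F 2 n ε₂₉ (zeta316OfRecord F 2 n.ν n.τ9.M n.A₁) (RzOfRecord F 2) (ZtOfRecord F 2)).τ9.M j X)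
            ((settingOfRecord₁₃ F 2 (theta13LiveOfNumerics F 2 n ε₂₉ (zeta316OfRecord F 2 n.ν n.τ9.M n.A₁) (RzOfRecord F 2) (ZtOfRecord F 2)) p).lf.alpha0 ((settingOfRecord₁₃ F 2 (theta13LiveOfNumerics F 2 n ε₂₉ (zeta316OfRecord F 2 n.ν n.τ9.M n.A₁) (RzOfRecord F 2) (ZtOfRecord F 2)) p).flow.g j)) ((settingOfRecord₁₃ F 2 (theta13LiveOfNumerics F 2 n ε₂₉ (zeta316OfRecord F 2 n.ν n.τ9.M n.A₁) (RzOfRecord F 2) (ZtOfRecord F 2)) p).lf.alpha1 ((settingOfRecord₁₃ F 2 (theta13LiveOfNumerics F 2 n ε₂₉ (zeta316OfRecord F 2 n.ν n.τ9.M n.A₁) (RzOfRecord F 2) (ZtOfRecord F 2)) p).flow.g j))) ∧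
      (Sect2.admB (F.P p.K) (theta13LiveOfNumerics F 2 n ε₂₉ (zeta316OfRecord F 2 n.ν n.τ9.M n.A₁) (RzOfRecord F 2) (ZtOfRecord F 2)).ν (theta13LiveOfNumerics F 2 n ε₂₉ (zeta316OfRecord F 2 n.ν n.τ9.M n.A₁) (RzOfRecord F 2) (ZtOfRecord F 2)).τ9.M (gOfRecord₁₃ F 2 (theta13LiveOfNumerics F 2 n ε₂₉ (zeta316OfRecord F 2 n.ν n.τ9.M n.A₁) (RzOfRecord F 2) (ZtOfRecord F 2)) p) s.Ω s.Λ j (Sect2.domSites (F.P p.K) (theta13LiveOfNumerics F 2 n ε₂₉ (zeta316OfRecord F 2 n.ν n.τ9.M n.A₁) (RzOfRecord F 2) (ZtOfRecord F 2)).τ9.M j X) = true →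
        Sect2.ofBackgroundC (settingOfRecord₁₃ F 2 (theta13LiveOfNumerics F 2 n ε₂₉ (zeta316OfRecord F 2 n.ν n.τ9.M n.A₁) (RzOfRecord F 2) (ZtOfRecord F 2)) p).ι (UbgOfRecord₁₃Co F 2 (theta13LiveOfNumerics F 2 n ε₂₉ (zeta316OfRecord F 2 n.ν n.τ9.M n.A₁) (RzOfRecord F 2) (ZtOfRecord F 2)) p m s W) ∈
          Sect2.spaceMS (settingOfRecord₁₃ F 2 (theta13LiveOfNumerics F 2 n ε₂₉ (zeta316OfRecord F 2 n.ν n.τ9.M n.A₁) (RzOfRecord F 2) (ZtOfRecord F 2)) p) ((theta13LiveOfNumerics F 2 n ε₂₉ (zeta316OfRecord F 2 n.ν n.τ9.M n.A₁) (RzOfRecord F 2) (ZtOfRecord F 2)).Rz p.K) (theta13LiveOfNumerics F 2 n ε₂₉ (zeta316OfRecord F 2 n.ν n.τ9.M n.A₁) (RzOfRecord F 2) (ZtOfRecord F 2)).τ9.M j (Sect2.domSites (F.P p.K) (theta13LiveOfNumerics F 2 n ε₂₉ (zeta316OfRecord F 2 n.ν n.τ9.M n.A₁) (RzOfRecord F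 2) (ZtOfRecord F 2)).τ9.M j X) s.Ω)) :
    ∃ θ : Stage13Params F 2, θ.Provisos₁₃SepCo F 2 ∧ (θ.ZtUnity F 2 ∧ θ.SlotsNondegenerate₁₃ F 2) ∧ θ.Admissible F 2 :=
  ⟨_, provisos₁₃SepCo_theta13LiveOfNumerics_of_bgSepCo F 2 n ε₂₉ hM hM₁ hbgSepCo,
    ⟨ztUnity_theta13LiveOfNumerics F 2 n ε₂₉, slotsNondegenerate₁₃_theta13LiveOfNumerics_of_hasResiduals F 2 n ε₂₉⟩,
    admissible_theta13LiveOfNumerics F 2 _ _ _ hn hε'⟩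

end AllNumericsSepCo

end Literature.MathematicalPhysics.QuantumFieldTheory.Balaban1983to89.Node00

end
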